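import Literature.NumberTheory.LFunctions.SuzukiWeilChainBoundaryProofs
import Literature.NumberTheory.LFunctions.SuzukiWeilOrthogonalSetProofs
import HarnessLib

/-!
# De Branges' axiom (dB3) for `𝓗(E)` (Blaschke division) and the norm of Suzuki's chain `E_ξ𝖥(V(t))`

LINE 1 — LABEL: RH-FREE theorems (no `RiemannHypothesis` anywhere) serving the «Assume RH» statement
CJM Thm. 5.7 (`Suzuki2025_thm57`, the chain of de Branges subspaces `E𝖥(V(t)) ⊂ 𝓗(E)`) of the cell
rh-crit/dbl (M. Suzuki, Canad. J. Math. 2025 = arXiv:2301.00421v3). bears_on: B-C/B-P (LADDER-RH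
COLUMN 6 DBR). WHAT THIS IS NOT: two RH-free ingredients of a printed RH-consequence; nothing here
bears on the truth of RH.

## What is proved (RH-FREE)

* §A **axiom (dB3) for the tree's `DeBrangesSpace E`** (`E` Hermite–Biehler): if `F ∈ 𝓗(E)`,
  `w ∉ ℝ`, `F(w) = 0`, then `z ↦ ((z − w̄)/(z − w))F(z)` — realised as the entire function
  `z ↦ (z − w̄)·dslope F w z` — lies in `𝓗(E)` (`deBrangesSpace_blaschke_mem`) with the same
  `𝓗(E)`-norm (`deBrangesNormSq_blaschke`); Romanov, Thm. 19 (iii) / CJM Thm. 5.7 (dB3) for `𝓗(E)`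
  itself.
* §B **the Hilbert-space structure clause of CJM Thm. 5.7**: for `Φ` entire with `Φ = E_ξ f̂` on
  `ℂ₊`, `f ∈ L²(0,∞)`, `‖Φ‖²_{𝓗(E_ξ)} = ∫|Φ/E_ξ|² = 2π‖f‖²` (`deBrangesNormSq_eq_two_pi_mul_norm_sq`,
  from the cell's boundary identity `Φ/E_ξ = 𝖥f` a.e. and Plancherel `‖𝖥f‖² = 2π‖f‖²`); in
  particular clause 5 of `Suzuki2025_thm57` holds for every real `t ≥ 0` WITHOUT RH
  (`suzuki2025_thm57_clause5`).
No definition and no named fact is introduced.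

## References
* M. Suzuki, Canad. J. Math. 2025 = arXiv:2301.00421v3, Thm. 5.7 p. 16 (TeX l.1844–1950), axioms
  (dB1)–(dB3). [Suzuki2025WeilHilbertSpace]
* R. Romanov, *Canonical systems and de Branges spaces*, §13 Thm. 19. [Romanov2014]
-/

noncomputable section

open MeasureTheory Complex Filter Set Metric
open scoped ComplexConjugate Topology Real ENNReal

namespace Literature.NumberTheory.LFunctions

open Literature.Analysis.DeBrangesSpaces

/-! ## A. Blaschke division in `𝓗(E)` -/

/-- Off `w`, `(z − w̄)·dslope F w z = ((z − w̄)/(z − w))·F(z)` when `F(w) = 0` — the quotient of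
axiom (dB3) as an everywhere-defined function. RH-FREE.
[cite: Suzuki2025WeilHilbertSpace, CJM Thm. 5.7 p. 16, axiom (dB3) ("((z − w̄)/(z − w))Φ(z) ∈ 𝓗")] -/
theorem blaschke_dslope_apply_of_ne {F : ℂ → ℂ} {w z : ℂ} (hFw : F w = 0) (hz : z ≠ w) :
    (z - conj w) * dslope F w z = (z - conj w) / (z - w) * F z := by
  rw [dslope_of_ne _ hz, slope_def_field, hFw, sub_zero]
  ring

/-- `z ↦ (z − w̄)·dslope F w z` is entire for entire `F` (the removable singularity at `w` of the
quotient in axiom (dB3)). RH-FREE.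
[cite: Suzuki2025WeilHilbertSpace, CJM Thm. 5.7 p. 16, axiom (dB3); Romanov2014, §13 Theorem 19 (iii)] -/
theorem differentiable_blaschke_dslope {F : ℂ → ℂ} (hF : Differentiable ℂ F) (w : ℂ) :
    Differentiable ℂ (fun z : ℂ ↦ (z - conj w) * dslope F w z) :=
  (differentiable_id.sub (differentiable_const _)).mul
    (differentiableOn_univ.1 ((Complex.differentiableOn_dslope univ_mem).2 hF.differentiableOn))

/-- On the real axis the Blaschke factor has modulus one: `|x − w̄| = |x − w|`. [folklore] -/
private theorem norm_ofReal_sub_conj_div (x : ℝ) {w : ℂ} (hw : w.im ≠ 0) :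
    ‖((x : ℂ) - conj w) / ((x : ℂ) - w)‖ = 1 := by
  have hx : (x : ℂ) - w ≠ 0 := sub_ne_zero.2 fun e ↦ hw (by rw [← e, Complex.ofReal_im])
  rw [norm_div, div_eq_one_iff_eq (norm_ne_zero_iff.2 hx)]
  have : (x : ℂ) - conj w = conj ((x : ℂ) - w) := by rw [map_sub, Complex.conj_ofReal]
  rw [this, Complex.norm_conj]

/-- The diagonal kernel `K(z,z) = (|E(z)|² − |E(z̄)|²)/(4π Im z)` is continuous off the real axis.
[folklore] -/
private theorem continuousOn_deBrangesKernelDiag {E : ℂ → ℂ} (hE : Continuous E) :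
    ContinuousOn (deBrangesKernelDiag E) {z : ℂ | z.im ≠ 0} := by
  unfold deBrangesKernelDiag
  refine ContinuousOn.div ?_ ?_ fun z hz ↦ ?_
  · exact ((hE.norm.pow 2).sub ((hE.comp Complex.continuous_conj).norm.pow 2)).continuousOn
  · exact (continuous_const.mul Complex.continuous_im).continuousOn
  · exact mul_ne_zero (by positivity) hz

/-- **Axiom (dB3) for `𝓗(E)`** (`E` Hermite–Biehler): if `F ∈ 𝓗(E)` vanishes at a non-real `w`,
then `((z − w̄)/(z − w))F(z)` (the entire function `(z − w̄)·dslope F w z`) belongs to `𝓗(E)`.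
Proof over the tree's pointwise definition: `|Ψ/E| = |F/E|` on `ℝ`; the kernel bound holds near `w`
because `Ψ` is bounded and `K(z,z) > 0` is continuous on a closed ball around `w` avoiding `ℝ`, and
away from `w` because `|(z − w̄)/(z − w)| ≤ 5` there. RH-FREE.
[cite: Romanov2014, §13 Theorem 19 (iii); Suzuki2025WeilHilbertSpace, CJM Thm. 5.7 p. 16, axiom (dB3)] -/
theorem deBrangesSpace_blaschke_mem {E F : ℂ → ℂ} (hE : IsHermiteBiehler E)
    (hF : F ∈ DeBrangesSpace E) {w : ℂ} (hw : w.im ≠ 0) (hFw : F w = 0) :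
    (fun z : ℂ ↦ (z - conj w) * dslope F w z) ∈ DeBrangesSpace E := by
  obtain ⟨hd, h2, C, hC⟩ := DeBrangesSpace.mem_iff.mp hF
  set Ψ : ℂ → ℂ := fun z ↦ (z - conj w) * dslope F w z with hΨ
  have hΨd : Differentiable ℂ Ψ := differentiable_blaschke_dslope hd w
  have hΨeq : ∀ z : ℂ, z ≠ w → Ψ z = (z - conj w) / (z - w) * F z :=
    fun z hz ↦ blaschke_dslope_apply_of_ne hFw hz
  refine DeBrangesSpace.mem_iff.mpr ⟨hΨd, ?_, ?_⟩
  · -- `Ψ/E ∈ L²(ℝ)`: same modulus as `F/E`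
    have hmeas : AEStronglyMeasurable (fun x : ℝ ↦ Ψ x / E x) volume :=
      ((hΨd.continuous.measurable.comp Complex.measurable_ofReal).div
        (hE.differentiable.continuous.measurable.comp Complex.measurable_ofReal)).aestronglyMeasurable
    refine h2.of_le hmeas (Filter.Eventually.of_forall fun x ↦ ?_)
    have hx : (x : ℂ) ≠ w := fun e ↦ hw (by rw [← e, Complex.ofReal_im])
    rw [hΨeq x hx, mul_div_assoc, norm_mul, norm_ofReal_sub_conj_div x hw, one_mul]
  · -- the kernel bound
    set r : ℝ := |w.im| / 2 with hr
    have hr0 : 0 < r := by positivity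
    have hBim : ∀ z ∈ closedBall w r, z.im ≠ 0 := by
      intro z hz him
      have h1 : |z.im - w.im| ≤ ‖z - w‖ := by
        simpa using Complex.abs_im_le_norm (z - w)
      have h2 : ‖z - w‖ ≤ r := mem_closedBall_iff_norm.1 hz
      rw [him, zero_sub, abs_neg] at h1
      linarith
    -- `Ψ` is bounded on the ball
    obtain ⟨M, hM⟩ := (isCompact_closedBall w r).exists_bound_of_continuousOn
      hΨd.continuous.continuousOn
    -- `K(z,z)` has a positive minimum on the ball
    have hKc : ContinuousOn (deBrangesKernelDiag E) (closedBall w r) :=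
      (continuousOn_deBrangesKernelDiag hE.differentiable.continuous).mono fun z hz ↦ hBim z hz
    obtain ⟨z₀, hz₀, hmin⟩ := (isCompact_closedBall w r).exists_isMinOn
      ⟨w, mem_closedBall_self hr0.le⟩ hKc
    set k₀ := deBrangesKernelDiag E z₀ with hk₀
    have hk₀pos : 0 < k₀ := hE.deBrangesKernelDiag_pos (hBim z₀ hz₀)
    have hM0 : 0 ≤ M := (norm_nonneg _).trans (hM w (mem_closedBall_self hr0.le))
    refine ⟨M ^ 2 / k₀ + 25 * max C 0, fun z hz ↦ ?_⟩
    have hKpos : 0 < deBrangesKernelDiag E z := hE.deBrangesKernelDiag_pos hz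
    by_cases hzB : z ∈ closedBall w r
    · -- near `w`
      have h1 : ‖Ψ z‖ ^ 2 ≤ M ^ 2 := pow_le_pow_left₀ (norm_nonneg _) (hM z hzB) 2
      have h2 : k₀ ≤ deBrangesKernelDiag E z := hmin hzB
      have h3 : M ^ 2 ≤ M ^ 2 / k₀ * deBrangesKernelDiag E z := by
        rw [div_mul_eq_mul_div, le_div_iff₀ hk₀pos]
        exact mul_le_mul_of_nonneg_left h2 (sq_nonneg _)
      have h4 : 0 ≤ 25 * max C 0 * deBrangesKernelDiag E z := by positivity
      calc ‖Ψ z‖ ^ 2 ≤ M ^ 2 / k₀ * deBrangesKernelDiag E z := h1.trans h3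
        _ ≤ (M ^ 2 / k₀ + 25 * max C 0) * deBrangesKernelDiag E z := by rw [add_mul]; linarith
    · -- away from `w`: `|(z − w̄)/(z − w)| ≤ 5`
      have hzw : r < ‖z - w‖ := by
        rw [mem_closedBall_iff_norm, not_le] at hzB; exact hzB
      have hzw' : z ≠ w := by
        rintro rfl; rw [sub_self, norm_zero] at hzw; exact absurd hzw (not_lt.2 hr0.le)
      have hB5 : ‖(z - conj w) / (z - w)‖ ≤ 5 := by
        rw [norm_div, div_le_iff₀ (hr0.trans hzw)]
        have e : z - conj w = (z - w) + (w - conj w) := by ring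
        have hwc : w - conj w = ((2 * w.im : ℝ) : ℂ) * I := by
          apply Complex.ext <;> simp [two_mul]
        have hn : ‖w - conj w‖ = 2 * |w.im| := by
          rw [hwc, norm_mul, Complex.norm_I, mul_one, Complex.norm_real, Real.norm_eq_abs,
            abs_mul, abs_two]
        calc ‖z - conj w‖ ≤ ‖z - w‖ + ‖w - conj w‖ := by rw [e]; exact norm_add_le _ _
          _ = ‖z - w‖ + 4 * r := by rw [hn, hr]; ring
          _ ≤ 5 * ‖z - w‖ := by linarith
      rw [hΨeq z hzw', norm_mul, mul_pow]
      have h1 : ‖(z - conj w) / (z - w)‖ ^ 2 ≤ 25 := by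
        nlinarith [norm_nonneg ((z - conj w) / (z - w))]
      have h2 : ‖F z‖ ^ 2 ≤ max C 0 * deBrangesKernelDiag E z :=
        (hC z hz).trans (mul_le_mul_of_nonneg_right (le_max_left _ _) hKpos.le)
      have h3 : 0 ≤ M ^ 2 / k₀ * deBrangesKernelDiag E z :=
        mul_nonneg (div_nonneg (sq_nonneg _) hk₀pos.le) hKpos.le
      calc ‖(z - conj w) / (z - w)‖ ^ 2 * ‖F z‖ ^ 2 ≤ 25 * (max C 0 * deBrangesKernelDiag E z) :=
            mul_le_mul h1 h2 (sq_nonneg _) (by norm_num)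
        _ ≤ (M ^ 2 / k₀ + 25 * max C 0) * deBrangesKernelDiag E z := by rw [add_mul]; linarith

/-- The Blaschke quotient has the same `𝓗(E)`-norm (the Blaschke factor has modulus one on `ℝ`).
RH-FREE. [cite: Suzuki2025WeilHilbertSpace, CJM Thm. 5.7 p. 16, axiom (dB3) ("the equality of norms in (dB3) is trivial")] -/
theorem deBrangesNormSq_blaschke_dslope (E : ℂ → ℂ) {F : ℂ → ℂ} {w : ℂ} (hw : w.im ≠ 0)
    (hFw : F w = 0) :
    deBrangesNormSq E (fun z : ℂ ↦ (z - conj w) * dslope F w z) = deBrangesNormSq E F :=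
  deBrangesNormSq_blaschke_mul E F _ hw fun _ hz ↦ blaschke_dslope_apply_of_ne hFw hz

/-! ## B. The norm of the chain: `‖E_ξ f̂‖²_{𝓗(E_ξ)} = 2π‖f‖²` -/

/-- **`∫_ℝ |Φ/E_ξ|² = 2π‖f‖²` for `Φ` entire with `Φ = E_ξ f̂` on `ℂ₊`, `f ∈ L²(0,∞)`** — the
boundary identity `Φ/E_ξ = 𝖥f` a.e. (`div_lagariasE_ae_eq_suzukiFourierL2`) and Plancherel in the
convention (1.1), `‖𝖥f‖² = 2π‖f‖²`. RH-FREE.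
[cite: Suzuki2025WeilHilbertSpace, CJM Thm. 5.7 p. 16 (TeX l.1866–1868: "the Hilbert space structure is the one induced from V(t) … ⟨F,G⟩_𝓗 = ∫ F Ḡ |E|⁻²")] -/
theorem deBrangesNormSq_eq_two_pi_mul_norm_sq {Φ : ℂ → ℂ} {f : Lp ℂ 2 (volume : Measure ℝ)}
    (hf : f ∈ halfLineL2 0) (hΦ : Differentiable ℂ Φ)
    (hΦf : ∀ z : ℂ, 0 < z.im → Φ z = lagariasE z * upperHalfHat f z) :
    deBrangesNormSq lagariasE Φ = 2 * Real.pi * ‖f‖ ^ 2 := by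
  have hae := div_lagariasE_ae_eq_suzukiFourierL2 hf (fun x ↦ hΦ.continuous.continuousAt) hΦf
  unfold deBrangesNormSq
  rw [← norm_sq_suzukiFourierL2, SuzukiOrthogonalSet.norm_sq_eq_integral_norm_sq]
  refine integral_congr_ae ?_
  filter_upwards [hae] with x hx
  rw [hx]

/-- **Clause 5 of `Suzuki2025_thm57`, for every `t ≥ 0`, WITHOUT RH**: for `Φ` entire with
`Φ = E_ξ f̂` on `ℂ₊` and `f ∈ V(t)`, `‖Φ‖²_{𝓗(E_ξ)} = 2π‖f‖²`. RH-FREE.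
[cite: Suzuki2025WeilHilbertSpace, CJM Thm. 5.7 p. 16 (TeX l.1866–1868)] -/
theorem suzuki2025_thm57_clause5 {t : ℝ} (ht : 0 ≤ t) :
    ∀ Φ : ℂ → ℂ, ∀ f ∈ suzukiV t, Differentiable ℂ Φ →
      (∀ z : ℂ, 0 < z.im → Φ z = lagariasE z * upperHalfHat f z) →
        deBrangesNormSq lagariasE Φ = 2 * Real.pi * ‖f‖ ^ 2 :=
  fun _ _ hf hΦ hΦf ↦ deBrangesNormSq_eq_two_pi_mul_norm_sq
    (mem_suzukiV_iff.1 (suzukiV_antitone ht hf)).1 hΦ hΦf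

end Literature.NumberTheory.LFunctions

end
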